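import Literature.MathematicalPhysics.QuantumFieldTheory.Federbush1986.PhaseCellIVGaugeInterpolation
import Literature.MathematicalPhysics.QuantumFieldTheory.Federbush1986.PhaseCellIVCompactGroupTargets
import Literature.MathematicalPhysics.QuantumLattice.YangMillsClassical
import Literature.MathematicalPhysics.QuantumLattice.GaugeGroups

/-!
# Federbush, *A phase cell approach to Yang–Mills theory. IV. The choice of variables* (CMP **114** (1988) 317–343) —
# §11 (11.1), (11.5)–(11.6), Geometric Constructions 2 and 4 in the `d^g` form AT §11's OWN TARGET: gauges with values in
# the gauge group `G`, the infimum in (11.1) over `u ∈ G` acting by LEFT TRANSLATION — hypothesis-free for `U(N)`, `SU(N)` and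
# for the image `ρ(G)` of any compact group under a continuous unitary representation

statement-level skeleton of published theorems with citation tags; proofs where landed; nothing here is a claim about the Yang–Mills mass gap

Cell `lit-balaban`, reader/typer block **r19** (F4 fold owner), inventory row `F4.Def§11` of
`run/shared/lean/pub/lit-balaban/lit-balaban-r19/ROWS-F4.md`.

**Source.** P. Federbush, Commun. Math. Phys. **114** (1988) 317–343 [bib `Federbush1988PhaseCellIV`; lit store
`paper:doi-10-1007-bf01225039`, journal page = PDF page + 316].  §11 p. 336: «A gauge, `φ(x)`, on a set `𝓈 ⊂ R⁴` is defined as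
a mapping `φ : x → G`, `x ∈ 𝓈`.  If `φ₁` and `φ₂` are two such gauges defined on `𝓈`, we set `d^g(φ₁, φ₂)`, the distance between
`φ₁` and `φ₂`, to be `d^g(φ₁, φ₂) = Inf_{u ∈ G} sup_{x ∈ 𝓈} d(uφ₁(x), φ₂(x))` (11.1)»; p. 337: (11.5)–(11.6) (Geometric
Construction 2), `d` the metric on `G` («if `φ′₁(v_a)` and `φ′₁(v_b)` are close enough, then they may be joined by a geodesic»);
p. 338: Geometric Construction 4; Appendix A p. 339: «Let `M` be a compact differentiable manifold (without boundary) and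
provided with a Riemannian metric»; p. 342: «We now embed `M` in some Euclidean space `R^t`».  The `u ∈ G` of (11.1) is a
constant group element multiplying the gauge from the left (a global gauge transformation in the usual terminology — the
phrase is ours, not print's).

**What the tree had.** `PhaseCellIVGauge.GeomConstruction2Gauge Γ t M` / `GeomConstruction4Gauge Γ k t M` (p314251) are
(11.5)–(11.6) / Construction 4 with `d^g = gaugeDist Γ` (the tree's reading of (11.1)), DERIVED from the sup-distance forms for
every compact group `Γ` acting isometrically and continuously on `↥M` (`geomConstruction2Gauge_and_4Gauge_of_geomConstructions`);
and the sup-distance forms are PROVED for `M = Ψ(H)`, `H ⊆ M_N(ℂ)` any compact matrix group, `Ψ` any real-linear identification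
(`PhaseCellIVAppA.appA_of_isCompact_subgroup`, `appA_range_of_compact`, p04).  What was missing is the INSTANCE §11 uses:
`Γ = G` itself acting on the target `G ⊂ M_N(ℂ) ≅ ℝ^{2N²}` by left multiplication, which is isometric for the Frobenius
(= Euclidean) distance because `G` consists of unitaries.

**What this file proves** (no `sorry`, no new `Prop`-facts):
* §1 `frobCoord N : M_N(ℂ) ≃L[ℝ] EuclideanSpace ℝ (Fin (2·N·N))` — the real coordinates `(Re A_{ij}, Im A_{ij})` (index
  convention `Fin (2 * N * N)` as in `Analysis/Calculus/UnitaryGroupSubmanifold`), an ISOMETRY for the Frobenius norm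
  (`norm_sq_frobCoord`, `norm_frobCoord`), hence `dist (Ψ(UA)) (Ψ(UB)) = dist (Ψ A) (Ψ B)` for unitary `U`
  (`dist_frobCoord_unitary_mul`; Frobenius unitary invariance = the tree's `Matrix.frobenius_norm_unitaryGroup_mul`,
  [HornJohnson2013] Thm 2.2.2).
* §2 for a compact group `G` and a continuous unitary representation `ρ : G → U(N)`: the target `repTarget ρ = Ψ(ρ(G))`
  with the LEFT-TRANSLATION action `g • Ψ(A) = Ψ(ρ(g) A)` — a `MulAction`, isometric (`IsIsometricSMul`) and continuous
  (`ContinuousSMul`); compactness of `U(N)`, `SU(N)` is the tree's (`Matrix.unitaryGroup.instCompactSpace`,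
  `Matrix.specialUnitaryGroup.instCompactSpace` of `QuantumLattice/GaugeGroups`).
* §3–§4 **(11.5)–(11.6) and Construction 4 in the `d^g` form, `Γ = G` by left translation, PROVED** for `M = Ψ(ρ(G))`
  (`gaugeForms_repTarget`), in particular HYPOTHESIS-FREE for `U(N)` (`gaugeForms_unitaryGroup`) and `SU(N)`
  (`gaugeForms_specialUnitaryGroup`), together with the whole Appendix A bundle at these targets (`appA_repTarget`).
-/
namespace Literature.MathematicalPhysics.QuantumFieldTheory.Federbush1986

noncomputable section

open Set Metric
open scoped NNReal

namespace PhaseCellIVGauge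

open PhaseCellIVAppA

/-- Shorthand for this file: complex `N × N` matrices. -/
local notation "𝕄" N => Matrix (Fin N) (Fin N) ℂ

variable {N : ℕ}

/-! ## 1. The Frobenius-isometric real coordinates of `M_N(ℂ)` -/

section Coordinates

variable (N)

/-- Real coordinates of a complex matrix: `A ↦ (Re A_{ij}, Im A_{ij})_{i,j}` as an `ℝ`-linear equivalence onto
`ℝ^{N × N × 2}` (the target `G ⊂ M_N(ℂ)` of §11 read in a Euclidean space, as Appendix A does on p. 342: «We now embed `M` in some
Euclidean space `R^t`»). [cite: Federbush1988PhaseCellIV, §11 p. 336; Appendix A p. 342] -/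
def reImLin : (𝕄 N) ≃ₗ[ℝ] (Fin N × Fin N × Bool → ℝ) where
  toFun A k := cond k.2.2 (A k.1 k.2.1).im (A k.1 k.2.1).re
  invFun x i j := (x (i, j, false) : ℂ) + x (i, j, true) * Complex.I
  map_add' A B := by
    ext ⟨i, j, b⟩
    cases b <;> simp
  map_smul' c A := by
    ext ⟨i, j, b⟩
    cases b <;> simp
  left_inv A := by
    ext i j
    simp [Complex.re_add_im]
  right_inv x := by
    ext ⟨i, j, b⟩
    cases b <;> simp

/-- The index bijection `N × N × 2 ≃ Fin (2·N·N)`. [folklore] -/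
def reImIdx : (Fin N × Fin N × Bool) ≃ Fin (2 * N * N) :=
  Fintype.equivFinOfCardEq (by simp [Fintype.card_prod]; ring)

/-- **`Ψ_F`**: `M_N(ℂ) ≃L[ℝ] EuclideanSpace ℝ (Fin (2·N·N))`, the real coordinates read in Euclidean space (Appendix A's `R^t`,
`t = 2N²`; p. 342 «We now embed `M` in some Euclidean space `R^t`»). [cite: Federbush1988PhaseCellIV, §11 p. 336; Appendix A p. 342] -/
def frobCoord : (𝕄 N) ≃L[ℝ] EuclideanSpace ℝ (Fin (2 * N * N)) :=
  ({ reImLin N with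
      continuous_toFun := by
        refine continuous_pi fun k => ?_
        obtain ⟨i, j, b⟩ := k
        cases b
        · exact Complex.continuous_re.comp (continuous_id.matrix_elem i j)
        · exact Complex.continuous_im.comp (continuous_id.matrix_elem i j)
      continuous_invFun := by
        refine continuous_pi fun i => continuous_pi fun j => ?_
        show Continuous fun x : Fin N × Fin N × Bool → ℝ => (x (i, j, false) : ℂ) + x (i, j, true) * Complex.I
        fun_prop } : (𝕄 N) ≃L[ℝ] (Fin N × Fin N × Bool → ℝ)).trans
    ((EuclideanSpace.equiv (Fin N × Fin N × Bool) ℝ).symm.trans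
      (LinearIsometryEquiv.piLpCongrLeft 2 ℝ ℝ (reImIdx N)).toContinuousLinearEquiv)

variable {N}

/-- Coordinates of `Ψ_F`. [cite: Federbush1988PhaseCellIV, Appendix A p. 342 («We now embed `M` in some Euclidean space `R^t`»)] -/
theorem frobCoord_apply (A : 𝕄 N) (k : Fin (2 * N * N)) :
    frobCoord N A k = reImLin N A ((reImIdx N).symm k) := rfl

/-- `Ψ_F` is an isometry for the Frobenius norm: `‖Ψ_F A‖² = Σ_{ij} |A_{ij}|²` (so the `d` of (11.1) — the metric on `G`, p. 337 —
is read as the Frobenius = Euclidean chordal distance, as in all the tree's embedded readings of Appendix A).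
[cite: Federbush1988PhaseCellIV, (11.1) p. 336; §11 p. 337; Appendix A p. 342] -/
theorem norm_sq_frobCoord (A : 𝕄 N) : ‖frobCoord N A‖ ^ 2 = ∑ i, ∑ j, ‖A i j‖ ^ 2 := by
  rw [PiLp.norm_sq_eq_of_L2]
  simp_rw [frobCoord_apply]
  rw [(reImIdx N).symm.sum_comp (fun m => ‖reImLin N A m‖ ^ 2), Fintype.sum_prod_type]
  refine Finset.sum_congr rfl fun i _ => ?_
  rw [Fintype.sum_prod_type]
  refine Finset.sum_congr rfl fun j _ => ?_
  rw [Fintype.sum_bool, Complex.sq_norm, Complex.normSq_apply]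
  simp [reImLin, sq]
  ring

open scoped Matrix.Norms.Frobenius in
/-- … i.e. `‖Ψ_F A‖ = ‖A‖_F` (Frobenius norm). [cite: Federbush1988PhaseCellIV, (11.1) p. 336; Appendix A p. 342] -/
theorem norm_frobCoord (A : 𝕄 N) : ‖frobCoord N A‖ = ‖A‖ := by
  have h : ‖frobCoord N A‖ ^ 2 = ‖A‖ ^ 2 := by
    rw [norm_sq_frobCoord, Matrix.frobenius_norm_def, ← Real.rpow_natCast,
      ← Real.rpow_mul (Finset.sum_nonneg fun i _ => Finset.sum_nonneg fun j _ => by positivity)]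
    norm_num
  exact (sq_eq_sq₀ (norm_nonneg _) (norm_nonneg _)).mp h

open scoped Matrix.Norms.Frobenius in
/-- **Left translation by a unitary is an isometry of `Ψ_F(M_N(ℂ))`**: `dist (Ψ_F(UA)) (Ψ_F(UB)) = dist (Ψ_F A) (Ψ_F B)`
(Frobenius unitary invariance, [HornJohnson2013] Thm 2.2.2, the tree's `Matrix.frobenius_norm_unitaryGroup_mul`) — the
`uφ₁(x)`, `u ∈ G ⊆ U(N)`, of (11.1). [cite: Federbush1988PhaseCellIV, (11.1) p. 336 («`Inf_{u ∈ G} sup_{x ∈ 𝓈} d(uφ₁(x), φ₂(x))`»)] -/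
theorem dist_frobCoord_unitary_mul (U : Matrix.unitaryGroup (Fin N) ℂ) (A B : 𝕄 N) :
    dist (frobCoord N ((U : 𝕄 N) * A)) (frobCoord N ((U : 𝕄 N) * B)) = dist (frobCoord N A) (frobCoord N B) := by
  rw [dist_eq_norm, dist_eq_norm, ← map_sub, ← map_sub, ← Matrix.mul_sub, norm_frobCoord, norm_frobCoord,
    Matrix.frobenius_norm_unitaryGroup_mul]

end Coordinates

/-! ## 2. §11's target: gauges with values in `G` — the image of a continuous unitary representation, `G` acting by left translation -/

section Target

variable {G : Type*} [Group G] [TopologicalSpace G]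

/-- The matrix-valued representation underlying `ρ : G → U(N)`. [cite: Federbush1988PhaseCellIV, §11 p. 336 («a mapping `φ : x → G`»)] -/
def valRep (ρ : ContinuousMonoidHom G (Matrix.unitaryGroup (Fin N) ℂ)) : G →* 𝕄 N :=
  (Matrix.unitaryGroup (Fin N) ℂ).subtype.comp ρ.toMonoidHom

/-- `valRep ρ g = ρ g` as a matrix. [cite: Federbush1988PhaseCellIV, §11 p. 336 («a mapping `φ : x → G`»)] -/
@[simp] theorem valRep_apply (ρ : ContinuousMonoidHom G (Matrix.unitaryGroup (Fin N) ℂ)) (g : G) :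
    valRep ρ g = ((ρ g : Matrix.unitaryGroup (Fin N) ℂ) : 𝕄 N) := rfl

/-- `valRep ρ` is continuous. [cite: Federbush1988PhaseCellIV, §11 p. 336 («a mapping `φ : x → G`»)] -/
theorem continuous_valRep (ρ : ContinuousMonoidHom G (Matrix.unitaryGroup (Fin N) ℂ)) : Continuous (valRep ρ) :=
  continuous_subtype_val.comp (map_continuous ρ)

/-- **§11's target** (gauges are «a mapping `φ : x → G`», p. 336; Appendix A's `M` is applied with `M` = the gauge group, read in
`R^t` as on p. 342): the image `Ψ_F(ρ(G)) ⊆ EuclideanSpace ℝ (Fin (2·N·N))` of the group under a continuous unitary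
representation `ρ` (`ρ = id` for `G = U(N)`, the inclusion for `SU(N)`).
[cite: Federbush1988PhaseCellIV, §11 p. 336; Appendix A p. 339, p. 342] -/
def repTarget (ρ : ContinuousMonoidHom G (Matrix.unitaryGroup (Fin N) ℂ)) : Set (EuclideanSpace ℝ (Fin (2 * N * N))) :=
  frobCoord N '' Set.range (valRep ρ)

variable (ρ : ContinuousMonoidHom G (Matrix.unitaryGroup (Fin N) ℂ))

/-- `ρ(G)` is stable under left translation by `ρ(g)`. [cite: Federbush1988PhaseCellIV, (11.1) p. 336 (the `uφ₁(x)` of (11.1))] -/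
theorem mul_mem_range_valRep (g : G) {A : 𝕄 N} (hA : A ∈ Set.range (valRep ρ)) :
    ((ρ g : Matrix.unitaryGroup (Fin N) ℂ) : 𝕄 N) * A ∈ Set.range (valRep ρ) := by
  obtain ⟨h, rfl⟩ := hA
  exact ⟨g * h, by simp [map_mul]⟩

/-- The point of `M` with matrix `ρ(g) · Ψ_F⁻¹(x)`. [cite: Federbush1988PhaseCellIV, (11.1) p. 336 (the `uφ₁(x)` of (11.1))] -/
def leftTranslate (g : G) (x : ↥(repTarget ρ)) : ↥(repTarget ρ) :=
  ⟨frobCoord N (((ρ g : Matrix.unitaryGroup (Fin N) ℂ) : 𝕄 N) * (frobCoord N).symm x.1), by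
    obtain ⟨A, hA, hx⟩ := x.2
    refine ⟨((ρ g : Matrix.unitaryGroup (Fin N) ℂ) : 𝕄 N) * A, mul_mem_range_valRep ρ g hA, ?_⟩
    rw [← hx, ContinuousLinearEquiv.symm_apply_apply]⟩

/-- Underlying point of the left translate. [cite: Federbush1988PhaseCellIV, (11.1) p. 336 (the `uφ₁(x)` of (11.1))] -/
@[simp] theorem coe_leftTranslate (g : G) (x : ↥(repTarget ρ)) :
    ((leftTranslate ρ g x : ↥(repTarget ρ)) : EuclideanSpace ℝ (Fin (2 * N * N))) =
      frobCoord N (((ρ g : Matrix.unitaryGroup (Fin N) ℂ) : 𝕄 N) * (frobCoord N).symm x.1) := rfl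

/-- **The gauge group acting on its own image by left translation** `g • Ψ_F(A) = Ψ_F(ρ(g) A)` — the `uφ₁(x)`, `u ∈ G`, of
(11.1) «`d^g(φ₁, φ₂) = Inf_{u ∈ G} sup_{x ∈ 𝓈} d(uφ₁(x), φ₂(x))`». [cite: Federbush1988PhaseCellIV, (11.1) p. 336] -/
instance instMulActionRepTarget : MulAction G ↥(repTarget ρ) where
  smul := leftTranslate ρ
  one_smul x := by
    change leftTranslate ρ 1 x = x
    apply Subtype.ext
    simp
  mul_smul g h x := by
    change leftTranslate ρ (g * h) x = leftTranslate ρ g (leftTranslate ρ h x)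
    apply Subtype.ext
    simp [Matrix.mul_assoc]

/-- The action, unfolded. [cite: Federbush1988PhaseCellIV, (11.1) p. 336 (the `uφ₁(x)` of (11.1))] -/
theorem smul_def (g : G) (x : ↥(repTarget ρ)) : g • x = leftTranslate ρ g x := rfl

/-- **Left translation is isometric** (unitaries preserve the Frobenius = Euclidean distance), so the infimum of (11.1)
«`Inf_{u ∈ G} sup_{x ∈ 𝓈} d(uφ₁(x), φ₂(x))`» runs over isometries of the target, which is what the tree's derivation of the `d^g`
forms (`gauge_of_supDist_version`) needs. [cite: Federbush1988PhaseCellIV, (11.1) p. 336; §11 p. 337] -/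
instance instIsIsometricSMulRepTarget : IsIsometricSMul G ↥(repTarget ρ) :=
  ⟨fun g => Isometry.of_dist_eq fun x y => by
    rw [Subtype.dist_eq, Subtype.dist_eq, smul_def, smul_def, coe_leftTranslate, coe_leftTranslate,
      dist_frobCoord_unitary_mul, ContinuousLinearEquiv.apply_symm_apply, ContinuousLinearEquiv.apply_symm_apply]⟩

/-- **Left translation is jointly continuous** in `(g, x)`. [cite: Federbush1988PhaseCellIV, (11.1) p. 336] -/
instance instContinuousSMulRepTarget : ContinuousSMul G ↥(repTarget ρ) := by
  refine ⟨continuous_induced_rng.2 ?_⟩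
  have h1 : Continuous fun p : G × ↥(repTarget ρ) => ((ρ p.1 : Matrix.unitaryGroup (Fin N) ℂ) : 𝕄 N) :=
    continuous_subtype_val.comp ((map_continuous ρ).comp continuous_fst)
  have h2 : Continuous fun p : G × ↥(repTarget ρ) => (frobCoord N).symm p.2.1 :=
    (frobCoord N).symm.continuous.comp (continuous_subtype_val.comp continuous_snd)
  exact (frobCoord N).continuous.comp (h1.mul h2)

end Target

/-! ## 3. (11.5)–(11.6) and Construction 4 in the `d^g` form at §11's target, `Γ = G` by left translation -/

section Results

variable {G : Type*} [Group G] [TopologicalSpace G] [CompactSpace G]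
  (ρ : ContinuousMonoidHom G (Matrix.unitaryGroup (Fin N) ℂ))

/-- **Appendix A at the target `M = Ψ_F(ρ(G))`**: Theorems A.1 (every cap), A.2, A.3, A.4 (capped decls of record) and
Geometric Constructions 2, 4 (sup-distance forms) — the tree's `appA_range_of_compact` (p04) read through `Ψ_F`.
[cite: Federbush1988PhaseCellIV, Appendix A Theorems A.1–A.4 pp. 339–343; §11 pp. 337–338] -/
theorem appA_repTarget (n : ℕ) :
    ThmA1Emb n (2 * N * N) (repTarget ρ) ∧ ThmA2Emb n (2 * N * N) (repTarget ρ) ∧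
      ThmA3ContCap n (2 * N * N) (repTarget ρ) ∧ ThmA4ContCap n (2 * N * N) (repTarget ρ) ∧
      GeomConstruction2 (2 * N * N) (repTarget ρ) ∧ GeomConstruction4 n (2 * N * N) (repTarget ρ) :=
  appA_range_of_compact (valRep ρ) (continuous_valRep ρ) (frobCoord N) n

/-- **(11.5)–(11.6) (Geometric Construction 2) and Geometric Construction 4 WITH THE `d^g` OF (11.1), `u ∈ G` RANGING OVER
THE GAUGE GROUP ACTING BY LEFT TRANSLATION — PROVED** for `M = Ψ_F(ρ(G))`, `G` any compact group, `ρ` any continuous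
unitary representation, every cube dimension `k`. [cite: Federbush1988PhaseCellIV, (11.1) p. 336; (11.5)–(11.6) p. 337;
Geometric Construction 4 p. 338] -/
theorem gaugeForms_repTarget (k : ℕ) :
    GeomConstruction2Gauge G (2 * N * N) (repTarget ρ) ∧ GeomConstruction4Gauge G k (2 * N * N) (repTarget ρ) := by
  obtain ⟨-, -, -, -, h2, h4⟩ := appA_repTarget ρ k
  exact geomConstruction2Gauge_and_4Gauge_of_geomConstructions h2 h4

/-- Construction 1 (11.4) at the same target when `G` is connected. [cite: Federbush1988PhaseCellIV, (11.4) p. 337] -/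
theorem geomConstruction1_repTarget [ConnectedSpace G] : GeomConstruction1 (2 * N * N) (repTarget ρ) :=
  geomConstruction1_range_of_compact (valRep ρ) (continuous_valRep ρ) (frobCoord N)

end Results

/-! ## 4. The gauge groups `U(N)` and `SU(N)` themselves, hypothesis-free -/

section GaugeGroups

variable (N)

/-- `U(N)` as its own (identity) unitary representation. [folklore] -/
def unitaryRep : ContinuousMonoidHom (Matrix.unitaryGroup (Fin N) ℂ) (Matrix.unitaryGroup (Fin N) ℂ) :=
  ContinuousMonoidHom.id _

/-- The inclusion `SU(N) ↪ U(N)` as a continuous unitary representation. [folklore] -/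
def specialUnitaryRep : ContinuousMonoidHom (Matrix.specialUnitaryGroup (Fin N) ℂ) (Matrix.unitaryGroup (Fin N) ℂ) where
  toMonoidHom := Submonoid.inclusion Matrix.specialUnitaryGroup_le_unitaryGroup
  continuous_toFun := continuous_inclusion Matrix.specialUnitaryGroup_le_unitaryGroup

/-- The target of `unitaryRep` is `Ψ_F(U(N))`. [cite: Federbush1988PhaseCellIV, §11 p. 336 («a mapping `φ : x → G`»)] -/
theorem repTarget_unitaryRep :
    repTarget (unitaryRep N) = frobCoord N '' (Matrix.unitaryGroup (Fin N) ℂ : Set (𝕄 N)) := by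
  rw [repTarget]
  congr 1
  ext A
  constructor
  · rintro ⟨U, rfl⟩
    exact (unitaryRep N U).2
  · intro hA
    exact ⟨⟨A, hA⟩, rfl⟩

/-- The target of `specialUnitaryRep` is `Ψ_F(SU(N))`. [cite: Federbush1988PhaseCellIV, §11 p. 336 («a mapping `φ : x → G`»)] -/
theorem repTarget_specialUnitaryRep :
    repTarget (specialUnitaryRep N) = frobCoord N '' (Matrix.specialUnitaryGroup (Fin N) ℂ : Set (𝕄 N)) := by
  rw [repTarget]
  congr 1
  ext A
  constructor
  · rintro ⟨U, rfl⟩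
    exact U.2
  · intro hA
    exact ⟨⟨A, hA⟩, rfl⟩

/-- **(11.5)–(11.6) and Construction 4 in the `d^g` form for the gauge group `U(N)` acting on ITSELF by left translation —
hypothesis-free, every `N`, every cube dimension `k`** (compactness: the tree's instance `Matrix.unitaryGroup.instCompactSpace`). [cite: Federbush1988PhaseCellIV, (11.1) p. 336;
(11.5)–(11.6) p. 337; Geometric Construction 4 p. 338] -/
theorem gaugeForms_unitaryGroup (k : ℕ) :
    GeomConstruction2Gauge (Matrix.unitaryGroup (Fin N) ℂ) (2 * N * N) (repTarget (unitaryRep N)) ∧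
      GeomConstruction4Gauge (Matrix.unitaryGroup (Fin N) ℂ) k (2 * N * N) (repTarget (unitaryRep N)) :=
  gaugeForms_repTarget (unitaryRep N) k

/-- **The same for `SU(N)` acting on itself by left translation — hypothesis-free** (compactness: the tree's instance
`Matrix.specialUnitaryGroup.instCompactSpace`).
[cite: Federbush1988PhaseCellIV, (11.1) p. 336; (11.5)–(11.6) p. 337; Geometric Construction 4 p. 338] -/
theorem gaugeForms_specialUnitaryGroup (k : ℕ) :
    GeomConstruction2Gauge (Matrix.specialUnitaryGroup (Fin N) ℂ) (2 * N * N) (repTarget (specialUnitaryRep N)) ∧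
      GeomConstruction4Gauge (Matrix.specialUnitaryGroup (Fin N) ℂ) k (2 * N * N) (repTarget (specialUnitaryRep N)) :=
  gaugeForms_repTarget (specialUnitaryRep N) k

/-- … and the Appendix A bundle (A.1 every cap, A.2, A.3, A.4, Constructions 2, 4) for `U(N)` read through `Ψ_F`.
[cite: Federbush1988PhaseCellIV, Appendix A Theorems A.1–A.4 pp. 339–343; §11 pp. 337–338] -/
theorem appA_unitaryGroup_frob (n : ℕ) :
    ThmA1Emb n (2 * N * N) (repTarget (unitaryRep N)) ∧ ThmA2Emb n (2 * N * N) (repTarget (unitaryRep N)) ∧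
      ThmA3ContCap n (2 * N * N) (repTarget (unitaryRep N)) ∧ ThmA4ContCap n (2 * N * N) (repTarget (unitaryRep N)) ∧
      GeomConstruction2 (2 * N * N) (repTarget (unitaryRep N)) ∧ GeomConstruction4 n (2 * N * N) (repTarget (unitaryRep N)) :=
  appA_repTarget (unitaryRep N) n

end GaugeGroups

end PhaseCellIVGauge

end

end Literature.MathematicalPhysics.QuantumFieldTheory.Federbush1986
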